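import Literature.Geometry.Symplectic.SphereFamilyTwoChartLeaves
import Literature.Geometry.Symplectic.JSphereLocalFoliationFromTransverseFamily
import Summits.SmoothPoincare4.SmoothPoincare4.Theorems.SymplecticOrigamiGromovRecognitionRelEndGluedBasics
import Summits.SmoothPoincare4.SmoothPoincare4.Theorems.SymplecticOrigamiGromovRecognitionRelEndHelperProductNbhd

/-!
# The deformation family of `J`-spheres from the chart-level analytic core
(registered helper `helper_deformationFamily_of_core` of the stub `stub_deformationFamily`, line
`Sketch`, crux `WitnessCharge`, item stmt-SmoothPoincare4-7824)

Manifold-side packaging of the Hofer–Lizan–Sikorav deformation family (C. Wendl, *Holomorphic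
Curves in Low Dimensions*, LNM 2216 (2018), Thm. 2.46, in coordinates). An embedded
`J`-holomorphic two-chart sphere `(u₀, v₀)` (`v₀ z = u₀ z⁻¹`) with trivial normal bundle has a
glued map `F₀ : ℂℙ¹ → X` (`helper_gluedExists`) and a product neighbourhood `ι : ℂℙ¹ × ℂ ↪ X`
with `ι (θ, 0) = F₀ θ` (`helper_productNbhd`); the almost complex structure read through the two
product charts `prodChart i ι` is a `SphereACData` `𝒥` (`exists_sphereACData_of_productNbhd`).
The analytic core (hypothesis `Core`) hands, for this `𝒥`, a family `(Ξ₀ a, Ξ₁ a, Φ₀ a, Φ₁ a)`,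
`|a| < ε`, of solutions of the two chart Cauchy–Riemann equations on the discs of radius `2`,
clutched as a section of `T ℂℙ¹ ⊕ ℂ`, vanishing at `a = 0`, jointly `C^∞`, with `Φ₀ a 0 = a`.
The glued two-chart family `U a z = prodChart 0 ι (𝒥.vmap₀ (Ξ₀ a) (Φ₀ a) z)` (`|z| < 2`),
`= prodChart 1 ι (𝒥.vmap₁ (Ξ₁ a) (Φ₁ a) z⁻¹)` (`|z| ≥ 2`), `V a w = U a w⁻¹`
(`Literature/Geometry/Symplectic/SphereFamilyTwoChartGluing.lean`,
`SphereFamilyTwoChartLeaves.lean`) then has all the properties demanded by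
`stub_deformationFamily`: central leaf `(u₀, v₀)` (`glueU_zero`, `glueV_zero`),
`JX`-holomorphic leaves (`isJHolomorphic_glueU_glueV`), joint smoothness
(`contMDiffOn_glueU_glueV`), and effectiveness at the linearised normal level
(`fderiv_comp_glueU_zero_ne_zero`, using that `πN` vanishes on `range u₀` with onto
differential). No new definitions.
-/

noncomputable section

open scoped Manifold ContDiff Topology
open Set Filter Function Literature.Geometry.Symplectic Literature.Topology.FourManifolds
  Literature.Topology.FourManifolds.ComplexProjectiveSpace Literature.Geometry.Symplectic.SphereCR
  Summit.SmoothPoincare4.SmoothPoincare4.Theorems.GromovRecognitionRelEnd.CrossCapLaurent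

-- the prescribed namespace `Summit.<P>.<Sub>.…` duplicates `SmoothPoincare4` (P = Sub)
set_option linter.dupNamespace false

namespace Summit.SmoothPoincare4.SmoothPoincare4.Theorems.WitnessCharge.PencilIncompleteness

/-- **The deformation family from the chart-level analytic core** (registered helper
`helper_deformationFamily_of_core` of the stub `stub_deformationFamily`; Wendl 2018, Thm. 2.46 in
coordinates). Given, for every `SphereACData` `𝒥`, a family of solutions
`(Ξ₀ a, Ξ₁ a, Φ₀ a, Φ₁ a)`, `|a| < ε`, of the two chart Cauchy–Riemann equations on the discs of
radius `2`, clutched as a section of `T ℂℙ¹ ⊕ ℂ`, vanishing at `a = 0`, jointly `C^∞`, with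
`Φ₀ a 0 = a`: through every embedded `JX`-holomorphic two-chart sphere `(u₀, v₀)` with trivial
normal bundle (cut out in the open `N` by the submersion `πN`) passes a jointly `C^∞` family of
`JX`-holomorphic two-chart spheres `(U a, V a)`, `V a z = U a z⁻¹`, with central leaf `(u₀, v₀)`,
effective at the linearised normal level — namely the glued two-chart family read through the
product neighbourhood `ι : ℂℙ¹ × ℂ ↪ X` of `helper_productNbhd` and its chart data
`exists_sphereACData_of_productNbhd`. [cite: Wendl2018, Thm. 2.46] -/
theorem helper_deformationFamily_of_core : (∀ 𝒥 : Literature.Geometry.Symplectic.SphereCR.SphereACData, ∃ (ε : ℝ) (Ξ₀ Ξ₁ Φ₀ Φ₁ : ℂ → ℂ → ℂ), 0 < ε ∧ (∀ z : ℂ, Ξ₀ 0 z = 0 ∧ Φ₀ 0 z = 0 ∧ Ξ₁ 0 z = 0 ∧ Φ₁ 0 z = 0) ∧ (∀ a : ℂ, ‖a‖ < ε → ∀ w : ℂ, w ≠ 0 → Ξ₁ a w = -w ^ 2 * Ξ₀ a w⁻¹ ∧ Φ₁ a w = Φ₀ a w⁻¹) ∧ ContDiffOn ℝ ∞ (fun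 q : ℂ × ℂ => Ξ₀ q.1 q.2) (Metric.ball 0 ε ×ˢ Set.univ) ∧ ContDiffOn ℝ ∞ (fun q : ℂ × ℂ => Ξ₁ q.1 q.2) (Metric.ball 0 ε ×ˢ Set.univ) ∧ ContDiffOn ℝ ∞ (fun q : ℂ × ℂ => Φ₀ q.1 q.2) (Metric.ball 0 ε ×ˢ Set.univ) ∧ ContDiffOn ℝ ∞ (fun q : ℂ × ℂ => Φ₁ q.1 q.2) (Metric.ball 0 ε ×ˢ Set.univ) ∧ (∀ a : ℂ, ‖a‖ < ε → (∀ z : ℂ, ‖z‖ ≤ 2 → ‖Ξ₀ a z‖ < 2⁻¹ ∧ Literature.Geometry.Symplectic.CRExpression.crExpr 𝒥.J₀ (𝒥.vmap₀ (Ξ₀ a) (Φ₀ a)) z = 0) ∧ (∀ w : ℂ, ‖w‖ ≤ 2 → ‖Ξ₁ a w‖ < 2⁻¹ ∧ Literature.Geometry.Symplectic.CRExpression.crExpr 𝒥.J₁ (𝒥.vmap₁ (Ξ₁ a) (Φ₁ a)) w = 0)) ∧ (∀ a : ℂ, ‖a‖ < ε → Φ₀ a 0 = a)) → ∀ (X :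 Type) [TopologicalSpace X] [T2Space X] [SecondCountableTopology X] [ChartedSpace (EuclideanSpace ℝ (Fin 4)) X] [IsManifold (𝓡 4) ∞ X] (JX : AlmostComplexStructure (𝓡 4) ∞ X) (u₀ v₀ : ℂ → X) (N : Set X) (πN : X → ℂ), ContMDiff 𝓘(ℝ, ℂ) (𝓡 4) ∞ u₀ → ContMDiff 𝓘(ℝ, ℂ) (𝓡 4) ∞ v₀ → (∀ z : ℂ, z ≠ 0 → v₀ z = u₀ z⁻¹) → IsJHolomorphic (𝓡 4) (fun y => JX y) u₀ → IsJHolomorphic (𝓡 4) (fun y => JX y) v₀ → Injective u₀ → (∀ z, Injective (mfderiv 𝓘(ℝ, ℂ) (𝓡 4) u₀ z)) → Injective (mfderiv 𝓘(ℝ, ℂ) (𝓡 4) v₀ 0) → v₀ 0 ∉ range u₀ → IsOpen N → range u₀ ∪ {v₀ 0} ⊆ N → ContMDiffOn (𝓡 4) 𝓘(ℝ, ℂ) ∞ πN N → (∀ y ∈ N, Surjective (mfderiv (𝓡 4) 𝓘(ℝ, ℂ) πN y)) → {y | y ∈ N ∧ πN y = 0} = range u₀ ∪ {v₀ 0} →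 ∃ (ε : ℝ) (U V : ℂ → ℂ → X), 0 < ε ∧ (∀ z, U 0 z = u₀ z) ∧ (∀ w, V 0 w = v₀ w) ∧ (∀ a : ℂ, ‖a‖ < ε → (∀ z : ℂ, z ≠ 0 → V a z = U a z⁻¹) ∧ IsJHolomorphic (𝓡 4) (fun y => JX y) (U a) ∧ IsJHolomorphic (𝓡 4) (fun y => JX y) (V a)) ∧ ContMDiffOn 𝓘(ℝ, ℂ × ℂ) (𝓡 4) ∞ (fun q : ℂ × ℂ => U q.1 q.2) (Metric.ball 0 ε ×ˢ univ) ∧ ContMDiffOn 𝓘(ℝ, ℂ × ℂ) (𝓡 4) ∞ (fun q : ℂ × ℂ => V q.1 q.2) (Metric.ball 0 ε ×ˢ univ) ∧ (∀ c : ℂ, c ≠ 0 → (∃ z, (fderiv ℝ (fun a : ℂ => πN (U a z)) 0) c ≠ 0) ∨ (∃ w, (fderiv ℝ (fun a : ℂ => πN (V a w)) 0) c ≠ 0)) := by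
  intro hcore X _ _ _ _ _ JX u₀ v₀ N πN hu₀ hv₀ hc hJu₀ hJv₀ hinj hdu hdv hinf hN hSN hπ hdπ hzero
  -- the glued map, the product neighbourhood and the chart data of `JX`
  obtain ⟨F₀, hF₀u, hF₀v⟩ := helper_gluedExists X u₀ v₀ hu₀.continuous hv₀.continuous hc
  obtain ⟨_, _, ι, -, -, -, -, -, -, -, hιs, -, hιd, -, hιF, -⟩ :=
    helper_productNbhd X u₀ v₀ N πN F₀ hu₀ hv₀ hc hinj hdu hdv hinf hN hSN hπ hdπ hzero hF₀u hF₀v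
  obtain ⟨𝒥, hint₀, hint₁⟩ :=
    exists_sphereACData_of_productNbhd JX u₀ v₀ F₀ ι hJu₀ hJv₀ hF₀u hF₀v hιs hιd hιF
  -- the analytic core for these chart data
  obtain ⟨ε, Ξ₀, Ξ₁, Φ₀, Φ₁, hε, hzero', hclutch, hΞ₀s, hΞ₁s, hΦ₀s, hΦ₁s, hcr, hΦ₀0⟩ := hcore 𝒥
  have hΞ₀b : ∀ a : ℂ, ‖a‖ < ε → ∀ z : ℂ, ‖z‖ ≤ 2 → ‖Ξ₀ a z‖ < 2⁻¹ :=
    fun a ha z hz => ((hcr a ha).1 z hz).1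
  have hΞ₁b : ∀ a : ℂ, ‖a‖ < ε → ∀ w : ℂ, ‖w‖ ≤ 2 → ‖Ξ₁ a w‖ < 2⁻¹ :=
    fun a ha w hw => ((hcr a ha).2 w hw).1
  -- the glued two-chart family
  obtain ⟨U, hU⟩ : ∃ U : ℂ → ℂ → X, ∀ a z, U a z =
      if ‖z‖ < 2 then prodChart 0 ι (𝒥.vmap₀ (Ξ₀ a) (Φ₀ a) z)
      else prodChart 1 ι (𝒥.vmap₁ (Ξ₁ a) (Φ₁ a) z⁻¹) :=
    ⟨fun a z => if ‖z‖ < 2 then prodChart 0 ι (𝒥.vmap₀ (Ξ₀ a) (Φ₀ a) z)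
      else prodChart 1 ι (𝒥.vmap₁ (Ξ₁ a) (Φ₁ a) z⁻¹), fun _ _ => rfl⟩
  obtain ⟨V, hV⟩ : ∃ V : ℂ → ℂ → X, ∀ a w, V a w =
      if w = 0 then prodChart 1 ι (𝒥.vmap₁ (Ξ₁ a) (Φ₁ a) 0) else U a w⁻¹ :=
    ⟨fun a w => if w = 0 then prodChart 1 ι (𝒥.vmap₁ (Ξ₁ a) (Φ₁ a) 0) else U a w⁻¹,
      fun _ _ => rfl⟩
  have hU0 : ∀ z, U 0 z = u₀ z := glueU_zero hF₀u hF₀v hιF hc hzero' hU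
  have hV0 : ∀ w, V 0 w = v₀ w := glueV_zero hF₀v hιF hc hzero' hV hU0
  have hs := contMDiffOn_glueU_glueV hιs hclutch hΞ₀s hΞ₁s hΦ₀s hΦ₁s hΞ₀b hΞ₁b hU hV
  refine ⟨ε, U, V, hε, hU0, hV0, fun a ha => ⟨fun z hz => ?_, ?_⟩, hs.1, hs.2, fun c hc0 => ?_⟩
  · rw [hV, if_neg hz]
  · exact isJHolomorphic_glueU_glueV hιs hιd hint₀ hint₁ hclutch hΞ₀s hΞ₁s hΦ₀s hΦ₁s hcr hU hV ha
  · -- effectiveness at `z = 0` of the chart `U`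
    refine Or.inl ⟨0, ?_⟩
    have hax : ∀ z, prodChart 0 ι (z, 0) = u₀ z := prodChart_zero_axis hF₀u hιF
    have hπ0 : ∀ z, πN (u₀ z) = 0 := fun z => by
      have h : u₀ z ∈ {y | y ∈ N ∧ πN y = 0} := by rw [hzero]; exact Or.inl ⟨z, rfl⟩
      exact h.2
    have hsub : range u₀ ⊆ N := fun y hy => hSN (Or.inl hy)
    exact fderiv_comp_glueU_zero_ne_zero hιs hιd hax hN hsub hπ hdπ hπ0 hε hΞ₀s (hzero' 0).1
      (hzero' 0).2.1 hΦ₀0 (fun a => glueU_eq_chart₀ hU a (by norm_num)) hc0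

end Summit.SmoothPoincare4.SmoothPoincare4.Theorems.WitnessCharge.PencilIncompleteness

end
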